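import Summits.AtomisticToContinuum.HydrodynamicLimit.Theorems.InformationPercolationEngineChaosClosesEulerPressureValueK
import HarnessLib

/-!
# Collisional pressure value in band (crux `ChaosClosesEuler`, stmt-AtomisticToContinuum-15141, line `Sketch`,
# stub `stub_pressureValueOfEnskog`) — helper L: the boundary layers are paid by the Enskog statistics themselves

WHAT. (P3) Along ONE good orbit, the `|g|`-weighted, `ℬ[L]`-marked normalised count of the collisions `s ≤ t + 1` with
`[s, s + r] ⊆ [lo, hi]` is at most
`2 (∫_{t₀ ∈ [0,t+1]} ∫_{x₀} |K′_r − R′| + (hi − lo + 2r) · 16π L² C_gY η₀)`: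
the layer inequality of helper D bounds it by twice the window integral of the windowed statistic `K′_r` over
`t₀ ∈ [lo, hi]`; this is the pointwise-Enskog-collision defect plus the window integral of the Enskog prediction
`R′ = σ³∫ bt ∫ b_r F′`, `F′ = |g|(σ³ρ_r) Y(σ³ρ_r) B_r(ℬ)`, whose integrand has space integral `≤ 16πL² C_gY η₀/σ³`
at every instant (`B_r(ℬ) ≤ 16πL²ρ_r²`, one factor `σ³ρ_r < η₀` in band, `∫ρ_r = 1`) and whose tent weight lives on
`[lo − r, hi + r]` (window transpose of helper E with the constant coefficient).

References: elementary; C. Cercignani, R. Illner, M. Pulvirenti (1994) App. 4.A.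
-/

noncomputable section

namespace Summit.AtomisticToContinuum.HydrodynamicLimit.Theorems.ChaosClosesEulerPressureValue

open scoped BigOperators Topology Classical MeasureTheory ENNReal InnerProductSpace
open Filter Set MeasureTheory
open Literature.MathematicalPhysics.KineticTheory
open Literature.Analysis.FluidPDE
open Summit.AtomisticToContinuum.HydrodynamicLimit.Theorems.LocalSecondLawNegative
open Summit.AtomisticToContinuum.HydrodynamicLimit.Theorems.LocalSecondLawLedger
open Summit.AtomisticToContinuum.HydrodynamicLimit.Theorems.LocalSecondLawLedger.L
  (Mmom rhoC_eq_sum momC_apply_eq_sum momC_eq_sum kinC_eq_trace norm_sq_eq_sum)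

/-- The truncated stress mark `𝒯[L,k,l]` (local notation for an explicit lambda). -/
local notation3 "𝒯[" L ", " k ", " l "]" => fun q : V3 × V3 × V3 =>
  min |⟪q.2.1 - q.2.2, q.1⟫_ℝ| (4 * L) * (speedCutoff L ‖q.2.1‖ * speedCutoff L ‖q.2.2‖) * (clip1 (q.1 k) * clip1 (q.1 l))

/-- The dominating mark `ℬ[L]` (local notation for an explicit lambda). -/
local notation3 "ℬ[" L "]" => fun q : V3 × V3 × V3 => 4 * L * (speedCutoff L ‖q.2.1‖ * speedCutoff L ‖q.2.2‖)

section Layers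

open Function

variable {σ : ℝ} {N : ℕ} (Φ : HardSphereFlow (Torus.geometry (Fin 3)) (hsDiameter σ N) (N + 1)) {z : Phase N}

/-! ## §1 The layer Enskog integrand `F′ = |g|(σ³ρ) Y(σ³ρ) B_r(ℬ)` -/

/-- `F′` is jointly measurable along a good orbit. [folklore] -/
theorem measurable_Fprime (hz : z ∈ Φ.good) {ga : ℝ → ℝ} (hga : Continuous ga) (r L : ℝ) :
    Measurable (uncurry fun (s : ℝ) (x : T3) => ga (σ ^ 3 * rhoC r (Φ.flow s z) x) *
      contactValue (σ ^ 3 * rhoC r (Φ.flow s z) x) * pairFunctional r ℬ[L] (Φ.flow s z) x) := by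
  have hγ := measurable_flow_of_mem_good Φ hz
  have hρ : Measurable fun p : ℝ × T3 => σ ^ 3 * rhoC r (Φ.flow p.1 z) p.2 :=
    measurable_const.mul (ChaosClosesEulerReduction.measurable_rhoC_orbit hγ r)
  exact ((hga.measurable.comp hρ).mul (EvenStressEnskog.measurable_contactValue.comp hρ)).mul
    (measurable_pairFunctional_orbit Φ hz (continuous_sphereMark_markB L) r)

/-- `|F′| ≤ C_gY · 16πL² (3/(πr³))²` (`0 ≤ σ`, `0 < r`, `0 < L`). [folklore] -/
theorem abs_Fprime_le (hσ : 0 ≤ σ) {r L : ℝ} (hr : 0 < r) (hL : 0 < L) {ga : ℝ → ℝ} {CgY : ℝ}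
    (hgaY : ∀ b, 0 ≤ b → |ga b * contactValue b| ≤ CgY) (s : ℝ) (x : T3) :
    |ga (σ ^ 3 * rhoC r (Φ.flow s z) x) * contactValue (σ ^ 3 * rhoC r (Φ.flow s z) x) *
        pairFunctional r ℬ[L] (Φ.flow s z) x| ≤ CgY * (16 * Real.pi * L ^ 2 * (3 / (Real.pi * r ^ 3)) ^ 2) := by
  have hb : 0 ≤ σ ^ 3 * rhoC r (Φ.flow s z) x := mul_nonneg (pow_nonneg hσ 3) (rhoC_nonneg hr _ _)
  have hB := pairFunctional_markB_mem hL hr (Φ.flow s z) x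
  have hρ := ChaosClosesEulerReduction.rhoC_le hr (Φ.flow s z) x
  have hρ0 := rhoC_nonneg hr (Φ.flow s z) x
  rw [abs_mul, abs_of_nonneg hB.1]
  refine mul_le_mul (hgaY _ hb) (hB.2.trans ?_) hB.1 ((abs_nonneg _).trans (hgaY _ hb))
  have : rhoC r (Φ.flow s z) x ^ 2 ≤ (3 / (Real.pi * r ^ 3)) ^ 2 := pow_le_pow_left₀ hρ0 hρ 2
  exact mul_le_mul_of_nonneg_left this (by positivity)

/-- **The space integral of `|F′|` at every instant is `≤ 16πL² C_gY (η₀/σ³)`** when `ga` vanishes on `[η₀,∞)`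
(`0 < σ`, `0 < r < 1/2`, `0 < L`, `0 ≤ η₀`). [folklore] -/
theorem integral_abs_Fprime_le (hz : z ∈ Φ.good) (hσ : 0 < σ) {r L : ℝ} (hr : 0 < r) (hr2 : r < 1 / 2) (hL : 0 < L)
    {ga : ℝ → ℝ} (hga : Continuous ga) {CgY η₀ : ℝ} (hη₀ : 0 ≤ η₀)
    (hgaY : ∀ b, 0 ≤ b → |ga b * contactValue b| ≤ CgY) (hga0 : ∀ b, η₀ ≤ b → ga b = 0) (s : ℝ) :
    ∫ x, |ga (σ ^ 3 * rhoC r (Φ.flow s z) x) * contactValue (σ ^ 3 * rhoC r (Φ.flow s z) x) *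
        pairFunctional r ℬ[L] (Φ.flow s z) x| ≤ 16 * Real.pi * L ^ 2 * CgY * (η₀ / σ ^ 3) := by
  set w := Φ.flow s z with hw
  have hσ3 : 0 < σ ^ 3 := pow_pos hσ 3
  have hCgY : 0 ≤ CgY := (abs_nonneg _).trans (hgaY 0 le_rfl)
  have hpt : ∀ x, |ga (σ ^ 3 * rhoC r w x) * contactValue (σ ^ 3 * rhoC r w x) * pairFunctional r ℬ[L] w x| ≤
      16 * Real.pi * L ^ 2 * CgY * (η₀ / σ ^ 3) * rhoC r w x := by
    intro x
    have hρ0 := rhoC_nonneg hr w x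
    have hb : 0 ≤ σ ^ 3 * rhoC r w x := mul_nonneg hσ3.le hρ0
    have hB := pairFunctional_markB_mem hL hr w x
    by_cases hband : η₀ ≤ σ ^ 3 * rhoC r w x
    · rw [hga0 _ hband, zero_mul, zero_mul, abs_zero]; positivity
    · push Not at hband
      have hρle : rhoC r w x ≤ η₀ / σ ^ 3 := by rw [le_div_iff₀ hσ3, mul_comm]; exact hband.le
      rw [abs_mul, abs_of_nonneg hB.1]
      calc |ga (σ ^ 3 * rhoC r w x) * contactValue (σ ^ 3 * rhoC r w x)| * pairFunctional r ℬ[L] w x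
          ≤ CgY * (16 * Real.pi * L ^ 2 * rhoC r w x ^ 2) := mul_le_mul (hgaY _ hb) hB.2 hB.1 hCgY
        _ = 16 * Real.pi * L ^ 2 * CgY * (rhoC r w x * rhoC r w x) := by ring
        _ ≤ 16 * Real.pi * L ^ 2 * CgY * (η₀ / σ ^ 3 * rhoC r w x) := by
            refine mul_le_mul_of_nonneg_left (mul_le_mul_of_nonneg_right hρle hρ0) (by positivity)
        _ = _ := by ring
  have hm := measurable_Fprime Φ hz hga r L (σ := σ)
  have hI : Integrable (fun x => |ga (σ ^ 3 * rhoC r w x) * contactValue (σ ^ 3 * rhoC r w x) *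
      pairFunctional r ℬ[L] w x|) volume := (integrable_slice hm (abs_Fprime_le Φ hσ.le hr hL hgaY) s).abs
  have hcρ : Continuous (rhoC r w) := by
    have h1 : (rhoC r w) = fun x => ((N + 1 : ℕ) : ℝ)⁻¹ * ∑ i, cone r (w i).1 x := funext fun x => rhoC_eq_sum r w x
    rw [h1]; exact continuous_const.mul (continuous_finsetSum _ fun i _ => continuous_cone r _)
  have hIρ : Integrable (fun x => 16 * Real.pi * L ^ 2 * CgY * (η₀ / σ ^ 3) * rhoC r w x) volume :=
    (integrable_of_continuous_T3 hcρ).const_mul _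
  calc _ ≤ ∫ x, 16 * Real.pi * L ^ 2 * CgY * (η₀ / σ ^ 3) * rhoC r w x := integral_mono hI hIρ hpt
    _ = 16 * Real.pi * L ^ 2 * CgY * (η₀ / σ ^ 3) := by
        rw [integral_const_mul, integral_rhoC_eq_one hr hr2, mul_one]

/-! ## §2 (P3) The layer count -/

/-- The window mass of the tent over `[lo, hi]` vanishes off `[lo − r, hi + r]` and lies in `[0, 1]`. [folklore] -/
theorem tentMass_facts {r : ℝ} (hr : 0 < r) (lo hi s : ℝ) :
    0 ≤ ∫ t₀ in Icc lo hi, r⁻¹ * max (1 - |s - t₀| / r) 0 ∧ (∫ t₀ in Icc lo hi, r⁻¹ * max (1 - |s - t₀| / r) 0) ≤ 1 ∧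
      (s ∉ Icc (lo - r) (hi + r) → ∫ t₀ in Icc lo hi, r⁻¹ * max (1 - |s - t₀| / r) 0 = 0) := by
  refine ⟨setIntegral_tent_nonneg hr s _, setIntegral_tent_le_one hr s _, fun hs => ?_⟩
  refine setIntegral_tent_eq_zero hr fun t₀ ht₀ => ?_
  simp only [mem_Icc, not_and_or, not_le] at hs
  rcases hs with h | h
  · rw [abs_of_neg (by linarith [ht₀.1])]; linarith [ht₀.1]
  · rw [abs_of_pos (by linarith [ht₀.2])]; linarith [ht₀.2]

/-- **(P3) The boundary layers are paid by the Enskog statistics.** For `0 ≤ lo ≤ hi ≤ t + 1`, a continuous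
nonnegative weight `ga` with `|ga · Y| ≤ C_gY` on `[0,∞)` and `ga = 0` on `[η₀,∞)` (`0 ≤ η₀`), `0 < σ`, `0 < r < 1/2`,
`0 < L`:
`K_{t+1}[1{lo ≤ s, s + r ≤ hi} ga ℬ] ≤ 2 (∫_{t₀ ∈ [0,t+1]} ∫_{x₀} |K′_r − R′| + σ³ (hi − lo + 2r) · 16πL² C_gY η₀/σ³)`.
[folklore] -/
theorem layer_count_le (hz : z ∈ Φ.good) (hσ : 0 < σ) {r L : ℝ} (hr : 0 < r) (hr2 : r < 1 / 2) (hL : 0 < L)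
    {t lo hi : ℝ} (hlo : 0 ≤ lo) (hlh : lo ≤ hi) (hhi : hi ≤ t + 1) {ga : ℝ → ℝ} (hga : Continuous ga)
    (hga_nn : ∀ b, 0 ≤ ga b) {CgY η₀ : ℝ} (hη₀ : 0 ≤ η₀) (hgaY : ∀ b, 0 ≤ b → |ga b * contactValue b| ≤ CgY)
    (hga0 : ∀ b, η₀ ≤ b → ga b = 0) :
    collisionSum σ N Φ (t + 1) (fun p => if lo ≤ p.1 ∧ p.1 + r ≤ hi then 1 else 0) ga ℬ[L] r z ≤
      2 * ((∫ t₀ in Icc 0 (t + 1), ∫ x₀,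
        |collisionSum σ N Φ (t + 1) (fun p => r⁻¹ * max (1 - |p.1 - t₀| / r) 0 * cone r p.2 x₀) ga ℬ[L] r z -
          σ ^ 3 * ∫ s in Icc 0 (t + 1), r⁻¹ * max (1 - |s - t₀| / r) 0 * ∫ x, cone r x x₀ *
            (ga (σ ^ 3 * rhoC r (Φ.flow s z) x) * contactValue (σ ^ 3 * rhoC r (Φ.flow s z) x) *
              pairFunctional r ℬ[L] (Φ.flow s z) x)|) +
        σ ^ 3 * ((hi - lo + 2 * r) * (16 * Real.pi * L ^ 2 * CgY * (η₀ / σ ^ 3)))) := by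
  set τ := t + 1 with hτ
  have hσ3 : 0 ≤ σ ^ 3 := pow_nonneg hσ.le 3
  have hCgY : 0 ≤ CgY := (abs_nonneg _).trans (hgaY 0 le_rfl)
  set CR : ℝ := 16 * Real.pi * L ^ 2 * CgY * (η₀ / σ ^ 3) with hCR
  have hCR0 : 0 ≤ CR := by rw [hCR]; positivity
  -- the three fields in the window centre
  set Fp : ℝ → T3 → ℝ := fun s x => ga (σ ^ 3 * rhoC r (Φ.flow s z) x) *
    contactValue (σ ^ 3 * rhoC r (Φ.flow s z) x) * pairFunctional r ℬ[L] (Φ.flow s z) x with hFp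
  have hFpm : Measurable (uncurry Fp) := measurable_Fprime Φ hz hga r L
  have hFpb : ∀ s x, |Fp s x| ≤ CgY * (16 * Real.pi * L ^ 2 * (3 / (Real.pi * r ^ 3)) ^ 2) :=
    abs_Fprime_le Φ hσ.le hr hL hgaY
  have hFpam : Measurable (uncurry fun s x => |Fp s x|) := hFpm.abs
  have hFpab : ∀ s x, |(|Fp s x|)| ≤ CgY * (16 * Real.pi * L ^ 2 * (3 / (Real.pi * r ^ 3)) ^ 2) := fun s x => by
    rw [abs_abs]; exact hFpb s x
  obtain ⟨hKm, CK, hKb⟩ := kwindow_measurable_bdd Φ hz hσ hr τ ga ℬ[L]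
  set Kf : ℝ → T3 → ℝ := fun t₀ x₀ =>
    collisionSum σ N Φ τ (fun p => r⁻¹ * max (1 - |p.1 - t₀| / r) 0 * cone r p.2 x₀) ga ℬ[L] r z with hKf
  set Rf : ℝ → T3 → ℝ := fun t₀ x₀ =>
    σ ^ 3 * ∫ s in Icc 0 τ, r⁻¹ * max (1 - |s - t₀| / r) 0 * ∫ x, cone r x x₀ * Fp s x with hRf
  set Rf2 : ℝ → T3 → ℝ := fun t₀ x₀ =>
    σ ^ 3 * ∫ s in Icc 0 τ, r⁻¹ * max (1 - |s - t₀| / r) 0 * ∫ x, cone r x x₀ * (|Fp s x|) with hRf2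
  have hRm : Measurable (uncurry Rf) := by
    have h := (measurable_windowField hr hFpm hFpb τ).const_mul (σ ^ 3); exact h
  have hR2m : Measurable (uncurry Rf2) := by
    have h := (measurable_windowField hr hFpam hFpab τ).const_mul (σ ^ 3); exact h
  set CF := CgY * (16 * Real.pi * L ^ 2 * (3 / (Real.pi * r ^ 3)) ^ 2) with hCF
  have hRb : ∀ t₀ x₀, |Rf t₀ x₀| ≤ σ ^ 3 * CF := fun t₀ x₀ => by
    simp only [hRf]; rw [abs_mul, abs_of_nonneg hσ3]
    exact mul_le_mul_of_nonneg_left (abs_windowField_le hr hr2 hFpb τ t₀ x₀) hσ3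
  have hR2b : ∀ t₀ x₀, |Rf2 t₀ x₀| ≤ σ ^ 3 * CF := fun t₀ x₀ => by
    simp only [hRf2]; rw [abs_mul, abs_of_nonneg hσ3]
    exact mul_le_mul_of_nonneg_left (abs_windowField_le hr hr2 hFpab τ t₀ x₀) hσ3
  have hconeL : ∀ x₀ : T3, Continuous fun x : T3 => cone r x x₀ := fun x₀ => by
    unfold cone
    refine continuous_const.mul ((continuous_const.sub (Continuous.div_const ?_ _)).max continuous_const)
    exact Torus.continuous_norm_reprSym.comp (continuous_id.sub continuous_const)
  -- `|R′| ≤ R″` pointwise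
  have hRR2 : ∀ t₀ x₀, |Rf t₀ x₀| ≤ Rf2 t₀ x₀ := by
    intro t₀ x₀
    simp only [hRf, hRf2]
    rw [abs_mul, abs_of_nonneg hσ3]
    refine mul_le_mul_of_nonneg_left ?_ hσ3
    refine (abs_integral_le_integral_abs).trans ?_
    have hm : Measurable (uncurry fun (s : ℝ) (x : T3) => cone r x x₀ * (|Fp s x|)) :=
      ((hconeL x₀).measurable.comp measurable_snd).mul hFpam
    have hb : ∀ s x, |cone r x x₀ * (|Fp s x|)| ≤ 3 / (Real.pi * r ^ 3) * CF := fun s x => by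
      rw [abs_mul, abs_of_nonneg (cone_nonneg hr _ _), abs_abs]
      exact mul_le_mul ((le_abs_self _).trans (LocalSecondLawLedger.L.abs_cone_le hr _ _)) (hFpb s x)
        (abs_nonneg _) (by positivity)
    have hI2 : IntegrableOn (fun s => r⁻¹ * max (1 - |s - t₀| / r) 0 * ∫ x, cone r x x₀ * (|Fp s x|)) (Icc 0 τ) := by
      haveI : IsFiniteMeasure ((volume : Measure ℝ).restrict (Icc 0 τ)) :=
        ⟨by rw [Measure.restrict_apply_univ, Real.volume_Icc]; exact ENNReal.ofReal_lt_top⟩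
      refine Integrable.of_bound ((((continuous_tent r).measurable.comp (measurable_id.sub measurable_const)).mul
        (measurable_integral_slice hm)).aestronglyMeasurable) (r⁻¹ * (3 / (Real.pi * r ^ 3) * CF))
        (ae_of_all _ fun s => ?_)
      have ht := ChaosClosesEulerWindowedInvariance.tent_nonneg_le hr (s - t₀)
      rw [Real.norm_eq_abs, abs_mul, abs_of_nonneg ht.1]
      exact mul_le_mul ht.2 (abs_integral_slice_le hb s) (abs_nonneg _) (inv_nonneg.2 hr.le)
    refine integral_mono_of_nonneg (ae_of_all _ fun s => abs_nonneg _) hI2 (ae_of_all _ fun s => ?_)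
    dsimp only
    have ht := ChaosClosesEulerWindowedInvariance.tent_nonneg_le hr (s - t₀)
    rw [abs_mul, abs_of_nonneg ht.1]
    refine mul_le_mul_of_nonneg_left ((abs_integral_le_integral_abs).trans ?_) ht.1
    refine integral_mono_of_nonneg (ae_of_all _ fun x => abs_nonneg _) ?_ (ae_of_all _ fun x => ?_)
    · exact integrable_slice hm hb s
    · dsimp only; rw [abs_mul, abs_of_nonneg (cone_nonneg hr _ _)]
  -- Step 1: the layer inequality
  have step1 := collisionSum_layer_le Φ hz hσ hr hr2 τ lo hi hga_nn (markB_nonneg hL)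
  refine step1.trans (mul_le_mul_of_nonneg_left ?_ zero_le_two)
  -- Step 2: `∫∫ K ≤ ∫∫ (|K − R| + R″)`
  have hGm : Measurable (uncurry fun t₀ x₀ => |Kf t₀ x₀ - Rf t₀ x₀| + Rf2 t₀ x₀) := (hKm.sub hRm).abs.add hR2m
  have hGb : ∀ t₀ x₀, |(|Kf t₀ x₀ - Rf t₀ x₀|) + Rf2 t₀ x₀| ≤ CK + σ ^ 3 * CF + σ ^ 3 * CF := fun t₀ x₀ =>
    (abs_add_le _ _).trans (add_le_add (by rw [abs_abs]; exact (abs_sub _ _).trans (add_le_add (hKb _ _) (hRb _ _)))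
      (hR2b _ _))
  have hdom : ∀ t₀ ∈ Icc lo hi, ∀ x₀, |Kf t₀ x₀| ≤ |Kf t₀ x₀ - Rf t₀ x₀| + Rf2 t₀ x₀ := fun t₀ _ x₀ => by
    have := abs_sub_abs_le_abs_sub (Kf t₀ x₀) (Rf t₀ x₀)
    linarith [hRR2 t₀ x₀]
  have h2 := abs_setIntegral_integral_le_of_le hGm hGb hdom
  have h2' : ∫ t₀ in Icc lo hi, ∫ x₀, Kf t₀ x₀ ≤ ∫ t₀ in Icc lo hi, ∫ x₀, (|Kf t₀ x₀ - Rf t₀ x₀| + Rf2 t₀ x₀) :=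
    (le_abs_self _).trans h2
  simp only [hKf] at h2'
  refine h2'.trans ?_
  have hDm : Measurable (uncurry fun t₀ x₀ => |Kf t₀ x₀ - Rf t₀ x₀|) := (hKm.sub hRm).abs
  have hDb : ∀ t₀ x₀, |(|Kf t₀ x₀ - Rf t₀ x₀|)| ≤ CK + σ ^ 3 * CF := fun t₀ x₀ => by
    rw [abs_abs]; exact (abs_sub _ _).trans (add_le_add (hKb _ _) (hRb _ _))
  rw [setIntegral_integral_add hDm hDb hR2m hR2b]
  refine add_le_add ?_ ?_
  · -- the defect over the sub-window
    have h := setIntegral_integral_mono_set hDm hDb (fun t₀ x₀ => abs_nonneg _) (Icc_subset_Icc hlo hhi)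
    simp only [hKf, hRf, hFp] at h
    exact h
  · -- the Enskog prediction over the sub-window: window transpose with the constant coefficient
    have hE := integral_integral_mul_window_eq (a := fun _ : ℝ × T3 => (1 : ℝ)) continuous_const (A := 1)
      (fun _ => by rw [abs_one]) hr hFpam hFpab σ lo hi τ
    simp only [one_mul] at hE
    simp only [hRf2]
    rw [hE]
    -- the tent mass weight
    have hW : ∀ s x, (∫ t₀ in Icc lo hi, ∫ x₀, r⁻¹ * max (1 - |s - t₀| / r) 0 * cone r x x₀) =
        ∫ t₀ in Icc lo hi, r⁻¹ * max (1 - |s - t₀| / r) 0 := by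
      intro s x
      refine integral_congr_ae (ae_of_all _ fun t₀ => ?_)
      dsimp only
      have h1 : ∫ x₀, cone r x x₀ = 1 := integral_cone_eq_one hr hr2 x
      rw [integral_const_mul, h1, mul_one]
    simp_rw [hW]
    -- majorant `1_{[lo−r, hi+r]}(s) |F′|`
    have hGm2 : Measurable (uncurry fun (s : ℝ) (x : T3) => (Icc (lo - r) (hi + r)).indicator (fun _ => (1 : ℝ)) s * (|Fp s x|)) :=
      ((measurable_const.indicator measurableSet_Icc).comp measurable_fst).mul hFpam
    have hind : ∀ s, 0 ≤ (Icc (lo - r) (hi + r)).indicator (fun _ => (1 : ℝ)) s ∧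
        (Icc (lo - r) (hi + r)).indicator (fun _ => (1 : ℝ)) s ≤ 1 := fun s => by
      by_cases h : s ∈ Icc (lo - r) (hi + r)
      · rw [Set.indicator_of_mem h]; exact ⟨zero_le_one, le_rfl⟩
      · rw [Set.indicator_of_notMem h]; exact ⟨le_rfl, zero_le_one⟩
    have hGb2 : ∀ s x, |(Icc (lo - r) (hi + r)).indicator (fun _ => (1 : ℝ)) s * (|Fp s x|)| ≤ CF := fun s x => by
      rw [abs_mul, abs_of_nonneg (hind s).1, abs_abs]
      calc _ ≤ 1 * CF := mul_le_mul (hind s).2 (hFpb s x) (abs_nonneg _) zero_le_one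
        _ = CF := one_mul _
    have hdom2 : ∀ s ∈ Icc (0 : ℝ) τ, ∀ x, |(∫ t₀ in Icc lo hi, r⁻¹ * max (1 - |s - t₀| / r) 0) * (|Fp s x|)| ≤
        (Icc (lo - r) (hi + r)).indicator (fun _ => (1 : ℝ)) s * (|Fp s x|) := by
      intro s _ x
      have hm := tentMass_facts hr lo hi s
      rw [abs_mul, abs_of_nonneg hm.1, abs_abs]
      refine mul_le_mul_of_nonneg_right ?_ (abs_nonneg _)
      by_cases h : s ∈ Icc (lo - r) (hi + r)
      · rw [Set.indicator_of_mem h]; exact hm.2.1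
      · rw [Set.indicator_of_notMem h, hm.2.2 h]
    have h3 := abs_setIntegral_integral_le_of_le hGm2 hGb2 hdom2
    refine mul_le_mul_of_nonneg_left ((le_abs_self _).trans (h3.trans ?_)) hσ3
    -- `∫_{[0,τ]} 1_{[lo−r,hi+r]}(s) ∫ₓ|F′| ≤ (hi − lo + 2r) CR`
    have hslice : ∀ s, ∫ x, (Icc (lo - r) (hi + r)).indicator (fun _ => (1 : ℝ)) s * (|Fp s x|) ≤
        (Icc (lo - r) (hi + r)).indicator (fun _ => (1 : ℝ)) s * CR := fun s => by
      rw [integral_const_mul]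
      exact mul_le_mul_of_nonneg_left (integral_abs_Fprime_le Φ hz hσ hr hr2 hL hga hη₀ hgaY hga0 s) (hind s).1
    haveI : IsFiniteMeasure ((volume : Measure ℝ).restrict (Icc 0 τ)) :=
      ⟨by rw [Measure.restrict_apply_univ, Real.volume_Icc]; exact ENNReal.ofReal_lt_top⟩
    have hIi : IntegrableOn (fun s => (Icc (lo - r) (hi + r)).indicator (fun _ => (1 : ℝ)) s * CR) (Icc 0 τ) :=
      ((integrable_const (1 : ℝ)).indicator measurableSet_Icc).mul_const CR
    calc ∫ s in Icc 0 τ, ∫ x, (Icc (lo - r) (hi + r)).indicator (fun _ => (1 : ℝ)) s * (|Fp s x|)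
        ≤ ∫ s in Icc 0 τ, (Icc (lo - r) (hi + r)).indicator (fun _ => (1 : ℝ)) s * CR :=
          setIntegral_mono_on (integrableOn_integral_slice hGm2 hGb2 0 τ) hIi measurableSet_Icc fun s _ => hslice s
      _ = (∫ s in Icc 0 τ, (Icc (lo - r) (hi + r)).indicator (fun _ => (1 : ℝ)) s) * CR := integral_mul_const _ _
      _ ≤ (hi - lo + 2 * r) * CR := by
          refine mul_le_mul_of_nonneg_right ?_ hCR0
          rw [setIntegral_indicator measurableSet_Icc, setIntegral_const, smul_eq_mul, mul_one]
          calc (volume : Measure ℝ).real (Icc 0 τ ∩ Icc (lo - r) (hi + r))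
              ≤ (volume : Measure ℝ).real (Icc (lo - r) (hi + r)) :=
                measureReal_mono Set.inter_subset_right (by rw [Real.volume_Icc]; exact ENNReal.ofReal_ne_top)
            _ = hi - lo + 2 * r := by
                rw [measureReal_def, Real.volume_Icc, ENNReal.toReal_ofReal (by linarith)]; ring

end Layers

/-! ## Registered sub-goal -/

/-- **Registered sub-goal `stub_pressureValueL` (helper L of `stub_pressureValueOfEnskog`): the tent mass over a
window vanishes one scale away from it.** [folklore] -/
theorem stub_pressureValueL : ∀ {r : ℝ}, 0 < r → ∀ (lo hi s : ℝ), s ∉ Set.Icc (lo - r) (hi + r) → ∫ t₀ in Set.Icc lo hi, r⁻¹ * max (1 - |s - t₀| / r) 0 = 0 :=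
  fun hr lo hi s hs => (tentMass_facts hr lo hi s).2.2 hs

end Summit.AtomisticToContinuum.HydrodynamicLimit.Theorems.ChaosClosesEulerPressureValue

end
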